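import Mathlib
import HarnessLib

/-!
# Route `KLProgramme` — crux K3, the nested two-volume pass: the LINEAR DEFECT RECURSION across the scales (the arithmetic spine of (vi);
# cell gate-hubbard-kl, seat hubbard-kl-k3c4-p1 g8; VL-STUB-ROUTE-A-g8.md §2/§5; `--supports` stmt-…-20440)

The inductive two-volume comparison (STEP `…TwoVolumeInductiveStep` + transfer `…TwoVolumeSubstitutionGluingDeepPin`) produces, scale by scale, deep-pin
defect sizes `E_j` obeying a LINEAR recursion `E_{j+1} ≤ A_j·E_j + s_j` with amplification factors `A_j` (homogeneous Lipschitz constants × re-sectorisation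
masses — any β-, j-dependent size is admissible because the VL stub is rate-free) and sources `s_j` (far covariance bracket, tails, zone bracket, substitution
tails — each `C_j(β)/L`).  This file is the bookkeeping that turns the per-scale inequalities into the bound at the last scale:

* **`defect_recursion_le`** — `E_n ≤ Amax^n · (E_0 + Σ_{j<n} s_j)` for `0 ≤ A_j ≤ Amax`, `1 ≤ Amax`, `0 ≤ s_j`, `0 ≤ E_0`;
* `defect_recursion_le_div` — with `E_0 ≤ c_0/L` and `s_j ≤ c_j/L`: `E_n ≤ Amax^n · (c_0 + Σ_{j<n} c_j) / L` — the rate `ρ(L) = C(β)/L` of VL-STUB-ROUTE-A-g8.md §2.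

Everything is proved; no definition; pure real arithmetic.
-/

noncomputable section

namespace Summit.HubbardSuperconductivity.HubbardSuperconductivity.Theorems.TwoVolumeDefect

set_option linter.dupNamespace false -- summit = problem name (single-conjunct summit), D-0017

open Finset

/-- **The linear defect recursion**: `E (j+1) ≤ A j * E j + s j` with `0 ≤ A j ≤ Amax`, `1 ≤ Amax`, `0 ≤ s j`, `0 ≤ E 0` gives
`E n ≤ Amax ^ n * (E 0 + Σ_{j < n} s j)`. [folklore] -/
theorem defect_recursion_le (E A s : ℕ → ℝ) {Amax : ℝ} (hAmax : 1 ≤ Amax) (hA0 : ∀ j, 0 ≤ A j) (hA : ∀ j, A j ≤ Amax)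
    (hs : ∀ j, 0 ≤ s j) (hE0 : 0 ≤ E 0) (hstep : ∀ j, E (j + 1) ≤ A j * E j + s j) (n : ℕ) :
    E n ≤ Amax ^ n * (E 0 + ∑ j ∈ range n, s j) := by
  induction n with
  | zero => simp
  | succ n ih =>
    have hEn : 0 ≤ E 0 + ∑ j ∈ range n, s j := add_nonneg hE0 (sum_nonneg fun j _ => hs j)
    have hEn' : 0 ≤ E n ∨ E n < 0 := le_or_gt 0 (E n)
    have hpow : 1 ≤ Amax ^ (n + 1) := one_le_pow₀ hAmax
    calc E (n + 1) ≤ A n * E n + s n := hstep n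
      _ ≤ Amax * (Amax ^ n * (E 0 + ∑ j ∈ range n, s j)) + s n := by
          refine add_le_add ?_ le_rfl
          rcases hEn' with h | h
          · exact (mul_le_mul_of_nonneg_left ih (hA0 n)).trans
              (mul_le_mul_of_nonneg_right (hA n) (mul_nonneg (pow_nonneg (zero_le_one.trans hAmax) n) hEn))
          · exact (mul_nonpos_iff.2 (Or.inl ⟨hA0 n, h.le⟩)).trans
              (mul_nonneg (zero_le_one.trans hAmax) (mul_nonneg (pow_nonneg (zero_le_one.trans hAmax) n) hEn))
      _ = Amax ^ (n + 1) * (E 0 + ∑ j ∈ range n, s j) + s n := by ring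
      _ ≤ Amax ^ (n + 1) * (E 0 + ∑ j ∈ range n, s j) + Amax ^ (n + 1) * s n :=
          add_le_add le_rfl (le_mul_of_one_le_left (hs n) hpow)
      _ = Amax ^ (n + 1) * (E 0 + ∑ j ∈ range (n + 1), s j) := by rw [sum_range_succ]; ring

/-- **The rate form**: `E 0 ≤ c 0 / L`, `s j ≤ c' j / L` give `E n ≤ Amax ^ n * (c 0 + Σ_{j<n} c′ j) / L` — the two-volume rate
`ρ(L) = C(β)/L` with `C(β)` exponential in the number of scales (harmless: the VL stub is rate-free). [folklore] -/
theorem defect_recursion_le_div (E A s : ℕ → ℝ) {Amax L : ℝ} (hAmax : 1 ≤ Amax) (hA0 : ∀ j, 0 ≤ A j) (hA : ∀ j, A j ≤ Amax)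
    (hs : ∀ j, 0 ≤ s j) (hE0 : 0 ≤ E 0) (hstep : ∀ j, E (j + 1) ≤ A j * E j + s j)
    (c : ℝ) (c' : ℕ → ℝ) (hc : E 0 ≤ c / L) (hc' : ∀ j, s j ≤ c' j / L) (n : ℕ) :
    E n ≤ Amax ^ n * (c + ∑ j ∈ range n, c' j) / L := by
  have h := defect_recursion_le E A s hAmax hA0 hA hs hE0 hstep n
  have hsum : E 0 + ∑ j ∈ range n, s j ≤ (c + ∑ j ∈ range n, c' j) / L := by
    rw [add_div, sum_div]
    exact add_le_add hc (sum_le_sum fun j _ => hc' j)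
  calc E n ≤ Amax ^ n * (E 0 + ∑ j ∈ range n, s j) := h
    _ ≤ Amax ^ n * ((c + ∑ j ∈ range n, c' j) / L) := mul_le_mul_of_nonneg_left hsum (pow_nonneg (zero_le_one.trans hAmax) n)
    _ = Amax ^ n * (c + ∑ j ∈ range n, c' j) / L := by ring

end Summit.HubbardSuperconductivity.HubbardSuperconductivity.Theorems.TwoVolumeDefect

end
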